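import Literature.Geometry.Riemannian.ColdingMinicozziEntropy
import HarnessLib

/-!
# Elementary estimates for the Gaussian area `F_{p,t}(A)`

Simple properties of the Colding–Minicozzi `F`-functional `F_{p,t}(A) = gaussianArea n p t A`
(`ColdingMinicozziEntropy.lean`) of a set `A` of finite area `μHE[n](A) < ∞`, the elementary
parts of Colding–Minicozzi 2012, Lemma 7.2 (1) and of the proof of Lemma 7.7:

* `gaussianArea_le_of_le_norm_sub`, `tendsto_farFactor` — a set at distance `≥ δ` from the
  centre has `F_{p,t}(A) ≤ (4πt)^{-n/2} e^{-δ²/4t} μHE[n](A)`, and this factor `→ 0` as `t → 0⁺`;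
* `tendsto_gaussianArea_atTop` — `F_{p,t}(A) → 0` as `t → ∞` (`n ≥ 1`);
* `continuousOn_lintegral_gaussianWeight`, `continuousOn_gaussianArea` — `(p, t) ↦ F_{p,t}(A)`
  is continuous on `E × (0, ∞)` (dominated convergence);
* `exists_forall_gaussianArea_le_of_lt_norm` — far centres, scales in a compact range: for a
  bounded `A ⊆ B̄(0, ρ)` and `0 < t₁ ≤ t₂`, `F_{y,t}(A)` is below any positive level for all
  `t ∈ [t₁, t₂]` once `‖y‖` is large ("`lim_{|x₀| → ∞} F_{x₀,t₀}(Σ) = 0`", proof of Lemma 7.7).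
(The first version of this file mislabelled Colding–Minicozzi's Lemma 7.7 — the entropy of a
closed hypersurface with `λ > 1` is achieved — as "Lemma 7.3"; the docstrings now carry the
journal numbering.)

Used by `ColdingMinicozziEntropyDensity.lean` (Lemma 7.2 (3)). Everything is proved; no
definitions and no named facts are introduced.

## References

* T. H. Colding, W. P. Minicozzi II, *Generic mean curvature flow I; generic singularities*,
  Ann. of Math. 175 (2012) 755–833, Lemma 7.2 and the proof of Lemma 7.7. [ColdingMinicozzi2012]
-/

noncomputable section

open Set Function Filter Module Metric
open _root_.MeasureTheory _root_.MeasureTheory.Measure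
open scoped ENNReal NNReal Topology

namespace Literature.Geometry.Riemannian

/-! ### Sets far from the centre; small scales -/

section Far

variable {E : Type*} [NormedAddCommGroup E] [MeasurableSpace E] [BorelSpace E]

/-- **The Gaussian area of a set far from the centre**: if every point of the measurable set
`A` has distance `≥ δ` from `p`, then `F_{p,t}(A) ≤ (4πt)^{-n/2} e^{-δ²/4t} · μHE[n](A)`
(the weight is at most `e^{-δ²/4t}` on `A`; Colding–Minicozzi 2012, proof of Lemma 7.7:
"`lim_{|x₀| → ∞} F_{x₀,t₀}(Σ) = 0` by the exponential decay of the weight function together with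
the compactness of `Σ`"). [cite: ColdingMinicozzi2012, Lemma 7.2] -/
theorem gaussianArea_le_of_le_norm_sub (n : ℕ) (p : E) {t : ℝ} (ht : 0 < t) {A : Set E}
    (hAm : MeasurableSet A) {δ : ℝ} (hδ : 0 ≤ δ) (hA : ∀ y ∈ A, δ ≤ ‖y - p‖) :
    gaussianArea n p t A ≤
      ENNReal.ofReal ((4 * Real.pi * t) ^ (-(n : ℝ) / 2) * Real.exp (-δ ^ 2 / (4 * t))) *
        (μHE[n] : Measure E) A := by
  rw [gaussianArea_eq, gaussianNormalization]
  have hw : ∀ y ∈ A, gaussianWeight p t y ≤ ENNReal.ofReal (Real.exp (-δ ^ 2 / (4 * t))) := by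
    intro y hy
    simp only [gaussianWeight]
    apply ENNReal.ofReal_le_ofReal
    apply Real.exp_le_exp.2
    have hsq : δ ^ 2 ≤ ‖y - p‖ ^ 2 := pow_le_pow_left₀ hδ (hA y hy) 2
    have h4 : (0 : ℝ) < 4 * t := by positivity
    rw [neg_div, neg_div, neg_le_neg_iff]
    exact div_le_div_of_nonneg_right hsq h4.le
  calc ENNReal.ofReal ((4 * Real.pi * t) ^ (-(n : ℝ) / 2)) *
        ∫⁻ y in A, gaussianWeight p t y ∂(μHE[n] : Measure E)
      ≤ ENNReal.ofReal ((4 * Real.pi * t) ^ (-(n : ℝ) / 2)) *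
          (ENNReal.ofReal (Real.exp (-δ ^ 2 / (4 * t))) * (μHE[n] : Measure E) A) :=
        mul_le_mul' le_rfl ((setLIntegral_mono' hAm hw).trans (le_of_eq (setLIntegral_const _ _)))
    _ = ENNReal.ofReal ((4 * Real.pi * t) ^ (-(n : ℝ) / 2) * Real.exp (-δ ^ 2 / (4 * t))) *
          (μHE[n] : Measure E) A := by
        rw [ENNReal.ofReal_mul (Real.rpow_nonneg (by positivity) _)]
        ring

/-- `(4πt)^{-n/2} e^{-δ²/4t} → 0` as `t → 0⁺` (`δ > 0`): as a function of `x = 1/t → ∞` it is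
`(4π)^{-n/2} x^{n/2} e^{-(δ²/4) x}` (Mathlib's `tendsto_rpow_mul_exp_neg_mul_atTop_nhds_zero`).
[folklore] -/
theorem tendsto_farFactor (n : ℕ) {δ : ℝ} (hδ : 0 < δ) :
    Tendsto (fun t : ℝ => (4 * Real.pi * t) ^ (-(n : ℝ) / 2) * Real.exp (-δ ^ 2 / (4 * t)))
      (𝓝[>] 0) (𝓝 0) := by
  -- as a function of `x = t⁻¹ → ∞`: `(4π)^{-n/2} x^{n/2} e^{-(δ²/4) x}`
  have h1 : Tendsto (fun x : ℝ => x ^ ((n : ℝ) / 2) * Real.exp (-(δ ^ 2 / 4) * x)) atTop (𝓝 0) :=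
    tendsto_rpow_mul_exp_neg_mul_atTop_nhds_zero _ _ (by positivity)
  have h2 := (h1.comp tendsto_inv_nhdsGT_zero).const_mul ((4 * Real.pi) ^ (-(n : ℝ) / 2))
  rw [mul_zero] at h2
  refine h2.congr' ?_
  filter_upwards [self_mem_nhdsWithin] with t ht
  rw [mem_Ioi] at ht
  simp only [Function.comp_apply]
  rw [Real.mul_rpow (by positivity) ht.le, neg_div, Real.rpow_neg ht.le, ← Real.inv_rpow ht.le]
  have : -(δ ^ 2 / 4) * t⁻¹ = -δ ^ 2 / (4 * t) := by
    field_simp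
  rw [this]
  ring

end Far

/-! ### Large scales -/

section LargeScale

variable {E : Type*} [NormedAddCommGroup E] [MeasurableSpace E] [BorelSpace E]

/-- **Large scales: `F_{p,t}(A) → 0` as `t → ∞`** for a set of finite area `μHE[n](A) < ∞`
(`n ≥ 1`), since `F_{p,t}(A) ≤ (4πt)^{-n/2} μHE[n](A)` (`gaussianArea_le_mul_measure`;
Colding–Minicozzi 2012, proof of Lemma 7.7: "the `F` functionals are strictly less than `λ(Σ)`
when `t₀` goes to either zero or infinity"). [cite: ColdingMinicozzi2012, Lemma 7.2] -/
theorem tendsto_gaussianArea_atTop {n : ℕ} (hn : 1 ≤ n) (p : E) {A : Set E}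
    (hA : (μHE[n] : Measure E) A < ∞) :
    Tendsto (fun t : ℝ => gaussianArea n p t A) atTop (𝓝 0) := by
  have hbound : ∀ t : ℝ, 0 ≤ t → gaussianArea n p t A ≤
      ENNReal.ofReal ((4 * Real.pi * t) ^ (-(n : ℝ) / 2)) * (μHE[n] : Measure E) A :=
    fun t ht => gaussianArea_le_mul_measure n p ht A
  have hlim : Tendsto (fun t : ℝ => ENNReal.ofReal ((4 * Real.pi * t) ^ (-(n : ℝ) / 2)) *
      (μHE[n] : Measure E) A) atTop (𝓝 0) := by
    have h1 : Tendsto (fun t : ℝ => (4 * Real.pi * t) ^ (-(n : ℝ) / 2)) atTop (𝓝 0) := by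
      have h2 : Tendsto (fun t : ℝ => 4 * Real.pi * t) atTop atTop :=
        Tendsto.const_mul_atTop (by positivity) tendsto_id
      have h3 := (tendsto_rpow_neg_atTop (y := (n : ℝ) / 2) (by positivity)).comp h2
      refine h3.congr fun t => ?_
      simp only [Function.comp_apply, neg_div]
    have h4 := ENNReal.tendsto_ofReal h1
    rw [ENNReal.ofReal_zero] at h4
    have h5 := ENNReal.Tendsto.mul_const h4 (Or.inr hA.ne)
    rwa [zero_mul] at h5
  refine tendsto_of_tendsto_of_tendsto_of_le_of_le' tendsto_const_nhds hlim
    (Eventually.of_forall fun t => bot_le) ?_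
  filter_upwards [eventually_ge_atTop 0] with t ht
  exact hbound t ht

end LargeScale

/-! ### Continuity in centre and scale -/

section Continuity

variable {E : Type*} [NormedAddCommGroup E] [MeasurableSpace E] [BorelSpace E]

/-- **Continuity of `(p, t) ↦ ∫_A e^{-‖x-p‖²/4t} dμHE[n]` on `E × (0, ∞)`** for a set of finite
area (dominated convergence with the bound `1`; the continuity part of Colding–Minicozzi 2012,
Lemma 7.2 (1): "`F_{x₀,t₀}(Σ)` is a smooth function of `x₀` and `t₀`").
[cite: ColdingMinicozzi2012, Lemma 7.2] -/
theorem continuousOn_lintegral_gaussianWeight (n : ℕ) {A : Set E}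
    (hA : (μHE[n] : Measure E) A < ∞) :
    ContinuousOn (fun q : E × ℝ => ∫⁻ x in A, gaussianWeight q.1 q.2 x ∂(μHE[n] : Measure E))
      (univ ×ˢ Ioi 0) := by
  intro q hq
  have hq2 : 0 < q.2 := hq.2
  -- dominated convergence with the bound `1`
  refine tendsto_lintegral_filter_of_dominated_convergence (fun _ => (1 : ℝ≥0∞)) ?_ ?_ ?_ ?_
  · exact Eventually.of_forall fun q' => measurable_gaussianWeight q'.1 q'.2
  · filter_upwards [self_mem_nhdsWithin] with q' hq'
    exact Eventually.of_forall fun x => gaussianWeight_le_one q'.1 (le_of_lt hq'.2) x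
  · rw [setLIntegral_one]
    exact hA.ne
  · refine Eventually.of_forall fun x => ?_
    have hcont : ContinuousAt (fun q' : E × ℝ => gaussianWeight q'.1 q'.2 x) q := by
      unfold gaussianWeight
      refine (ENNReal.continuous_ofReal.continuousAt).comp ?_
      refine Real.continuous_exp.continuousAt.comp ?_
      refine ContinuousAt.div (by fun_prop) (by fun_prop) ?_
      exact mul_ne_zero four_ne_zero hq2.ne'
    exact hcont.continuousWithinAt

/-- **Continuity of the Gaussian area `(p, t) ↦ F_{p,t}(A)` on `E × (0, ∞)`** for a set of
finite area `μHE[n](A) < ∞` (Colding–Minicozzi 2012, Lemma 7.2 (1), continuity part).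
[cite: ColdingMinicozzi2012, Lemma 7.2] -/
theorem continuousOn_gaussianArea (n : ℕ) {A : Set E} (hA : (μHE[n] : Measure E) A < ∞) :
    ContinuousOn (fun q : E × ℝ => gaussianArea n q.1 q.2 A) (univ ×ˢ Ioi 0) := by
  have h1 := continuousOn_lintegral_gaussianWeight n hA
  have h2 : ContinuousOn (fun q : E × ℝ => gaussianNormalization n q.2) (univ ×ˢ Ioi 0) := by
    intro q hq
    have hq2 : 0 < q.2 := hq.2
    unfold gaussianNormalization
    refine ((ENNReal.continuous_ofReal.continuousAt).comp ?_).continuousWithinAt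
    refine ContinuousAt.rpow_const (by fun_prop) (Or.inl ?_)
    exact (mul_pos (by positivity) hq2).ne'
  intro q hq
  have hfin : ∫⁻ x in A, gaussianWeight q.1 q.2 x ∂(μHE[n] : Measure E) ≠ ∞ := by
    refine ne_top_of_le_ne_top ?_ (lintegral_mono fun x => gaussianWeight_le_one q.1 (le_of_lt hq.2) x)
    rw [setLIntegral_one]
    exact hA.ne
  simp only [gaussianArea_eq]
  exact ENNReal.Tendsto.mul (h2 q hq) (Or.inr hfin) (h1 q hq)
    (Or.inr (gaussianNormalization_ne_top n q.2))

end Continuity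

/-! ### Far centres -/

section FarCentres

variable {E : Type*} [NormedAddCommGroup E] [MeasurableSpace E] [BorelSpace E]

/-- **Far centres, scales in a compact range.** For a measurable set `A ⊆ B̄(0, ρ)` of finite
area, `0 < t₁ ≤ t₂` and a level `c > 0`, there is `R` with `F_{y,t}(A) ≤ c` for all `t ∈ [t₁, t₂]`
and all centres with `‖y‖ > R`: `F_{y,t}(A) ≤ (4πt₁)^{-n/2} e^{-D²/4t₂} μHE[n](A)` when every point
of `A` is `D`-far from `y` (Colding–Minicozzi 2012, proof of Lemma 7.7: "for each fixed `t₀ > 0`,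
`lim_{|x₀| → ∞} F_{x₀,t₀}(Σ) = 0` by the exponential decay of the weight function together with
the compactness of `Σ`"). [cite: ColdingMinicozzi2012, Lemma 7.7] -/
theorem exists_forall_gaussianArea_le_of_lt_norm (n : ℕ) {A : Set E} (hAm : MeasurableSet A)
    (hA : (μHE[n] : Measure E) A < ∞) {ρ : ℝ} (hρ : A ⊆ closedBall (0 : E) ρ) {t₁ t₂ : ℝ}
    (ht₁ : 0 < t₁) (ht₁₂ : t₁ ≤ t₂) {c : ℝ≥0∞} (hc : 0 < c) :
    ∃ R : ℝ, ∀ (y : E) (t : ℝ), t₁ ≤ t → t ≤ t₂ → R < ‖y‖ → gaussianArea n y t A ≤ c := by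
  have ht₂ : 0 < t₂ := ht₁.trans_le ht₁₂
  have hfar_lim : Tendsto (fun D : ℝ => ENNReal.ofReal ((4 * Real.pi * t₁) ^ (-(n : ℝ) / 2) *
      Real.exp (-D ^ 2 / (4 * t₂))) * (μHE[n] : Measure E) A) atTop (𝓝 0) := by
    have h1 : Tendsto (fun D : ℝ => D ^ 2 / (4 * t₂)) atTop atTop :=
      (tendsto_pow_atTop two_ne_zero).atTop_div_const (by positivity)
    have h2 : Tendsto (fun D : ℝ => Real.exp (-(D ^ 2 / (4 * t₂)))) atTop (𝓝 0) :=
      Real.tendsto_exp_neg_atTop_nhds_zero.comp h1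
    have h3 := h2.const_mul ((4 * Real.pi * t₁) ^ (-(n : ℝ) / 2))
    rw [mul_zero] at h3
    have h4 := ENNReal.tendsto_ofReal h3
    rw [ENNReal.ofReal_zero] at h4
    have h5 := ENNReal.Tendsto.mul_const h4 (Or.inr hA.ne)
    rw [zero_mul] at h5
    refine h5.congr fun D => ?_
    simp only [neg_div]
  obtain ⟨D₀, hD₀⟩ := (hfar_lim.eventually (gt_mem_nhds hc)).exists_forall_of_atTop
  set D := max D₀ 0 with hD
  have hDnn : 0 ≤ D := le_max_right _ _
  refine ⟨ρ + D, fun y t h1 h2 hy => ?_⟩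
  have ht : 0 < t := ht₁.trans_le h1
  have hdist : ∀ z ∈ A, D ≤ ‖z - y‖ := by
    intro z hz
    have hzρ : ‖z‖ ≤ ρ := mem_closedBall_zero_iff.1 (hρ hz)
    have := norm_sub_norm_le y z
    rw [norm_sub_rev] at this
    linarith
  calc gaussianArea n y t A
      ≤ ENNReal.ofReal ((4 * Real.pi * t) ^ (-(n : ℝ) / 2) * Real.exp (-D ^ 2 / (4 * t))) *
          (μHE[n] : Measure E) A :=
        gaussianArea_le_of_le_norm_sub n y ht hAm hDnn hdist
    _ ≤ ENNReal.ofReal ((4 * Real.pi * t₁) ^ (-(n : ℝ) / 2) * Real.exp (-D ^ 2 / (4 * t₂))) *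
          (μHE[n] : Measure E) A := by
        refine mul_le_mul' (ENNReal.ofReal_le_ofReal ?_) le_rfl
        refine mul_le_mul ?_ ?_ (Real.exp_pos _).le (Real.rpow_nonneg (by positivity) _)
        · rw [neg_div, Real.rpow_neg (by positivity), Real.rpow_neg (by positivity)]
          refine inv_anti₀ (Real.rpow_pos_of_pos (by positivity) _) ?_
          exact Real.rpow_le_rpow (by positivity) (by nlinarith [Real.pi_pos]) (by positivity)
        · refine Real.exp_le_exp.2 ?_
          rw [neg_div, neg_div, neg_le_neg_iff]
          exact div_le_div_of_nonneg_left (by positivity) (by positivity) (by linarith)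
    _ ≤ c := (hD₀ D (le_max_left _ _)).le

end FarCentres

end Literature.Geometry.Riemannian

end
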